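import Summits.ABC.IUTFork.Cor312UnitCosetShell
import Summits.ABC.IUTFork.Cor312UnitCosetShellCells
import Summits.ABC.IUTFork.Repair.EvalCoarseProfile
import Summits.ABC.IUTFork.Repair.CandMochizuki41
import HarnessLib

/-!
# IUT REPAIR branch, §A on the GRADED-SHELL coset family `ksSetting p δ` («K-fat», EVERY depth function `δ`) — the shell rescues NO §A row
# (abc-iut-rp-cx, gen 2)

PROOF-ONLY record file (no definition, no `Prop` fact; inputs consumed BY NAME) of the abc-iut cell, IUT REPAIR branch (rung LADDER-ABC:A2.RP;
lead abc-iut-rp-plan), seat abc-iut-rp-cx (refuter; T-b/T-c engine). TAKES NO SIDE on [IUTchIII] Cor. 3.12 or on any author (Mochizuki /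
Scholze–Stix / Joshi / Dupuy–Hilado); candidates are hypotheses H with «H ∧ interface ⊢ Cor 3.12» as the target shape; typed ≠ proved;
model data ≠ intended objects.

WHAT. abc-iut-w4-d101 (gen 6) answered this seat's bed request «K-fat» (XREAD-8 §4; MODEL-SPACE LIMIT #5) with the graded-shell coset family
`Cor312UnitCosetShell.ksSetting p δ` — bed K (`UnitCosetCoarse.kSetting`, p441039) with the mono-analytic log-shell (i)(a) made a parameter
`𝓘_j = p^{−δ_j}·𝒪` ([IUTchIII] Thm. 3.11 (i)(a), (Ind3)); K is `δ ≡ 0`. This file is the cx §A column on that family, for EVERY `δ`, each cell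
the author's honest-data lemma (`ksSetting_bridgeHyps`, `ksSetting_scaled`, `ksSetting_indep`, `ksSetting_absLogQPos`, `ksSetting_thetaRegion3_adm`,
`ksLine_hAdm`, `ksLine_logvolInvariant`, `ksFull_statement`) fed to a landed ceiling BY NAME:
* KUMMER-image rows — RP-X04a ✗ `x04_false_ks`, RP-C01-VT ✗ `volumeTransport_false_ks`, RP-C01-GVT ✗ `globalVolumeTransport_false_ks`,
  RP-C01-QFC ✗ `qFrobComparison_false_ks`, RP-I17 ✗ `not_hDegreeOrbitGe_ks` (RP-I16 ✓ `hDegreeOrbit_ks`, insufficient as everywhere);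
* POSSIBLE-image rows — RP-L01 ✗ ∀ `ρ qK` `l01_false_ks`, RP-J02 ✗ `j02_false_ks`, RP-M32b ✗ ∀ `ρ qK` `m32b_false_ks`;
* RP-M51 ((C14)/(Lin)-denial, abc-iut-rp-m4 `CandMochizuki41.H`) ✓ `m41_holds_ks` — with `Statement` ✓ and `¬S`, INSUFFICIENT@S as at K.
So the depth function `δ` — the ONLY new datum of the family — is read by NONE of these rows (Θ- and q-regions, volumes, (Ind1)/(Ind2), pins and
the Statement are K's): the log-shell rescues no §A row and does not disturb RP-M51; by w4-d101's announcement the rows that DO read `δ` are the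
log-shell rows RP-I05 / RP-I05c / RP-I06⋆ (`Cor312UnitCosetShellCells`), where the cx container ceiling `EvalContainerCeiling` (p443880) names the
escape (a container of volume `> j²·qLocal`). Package: `shell_column_sectionA`; and at the THRESHOLD depth `δ⋆ = j²−1` (w4-d101's `containers_dStar`, p445248: RP-I05 ∧ RP-I05c ∧ RP-I06 ∧ RP-I06⋆ HOLD — MODEL-SPACE LIMIT #5's SAT⁺ witness) `limit5_witness_sectionA` (v3 append): the witness carries every §A row FALSE and `¬S`. One place (`toyIndex`, `l⋇ = 2`); a model of the typed interface,
not of initial Θ-data; no judgement on print. [claim: Mochizuki2012, status: disputed] [cite: ScholzeStix2018, §2.2 pp. 9–10]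
[cite: Joshi2024CIII, §1] [cite: DupuyHilado2020, §1]
-/

noncomputable section

namespace Summit.ABC.IUTFork.Repair.EvalShellProfile

open Set Cor312 Cor312.Checks Cor312.IdentifiedNonVacuity Cor312Vol Cor312Vol.NaiveWitness Cor312Vol.PinnedWitness
  Cor312Vol.UnitWitness Cor312Vol.UnitCoset Cor312Vol.UnitCosetCoarse Cor312Vol.UnitCosetShell Literature.IUT.LogThetaLattice
open Thm311 hiding toyIndex

variable (p : ℕ) [hp : Fact p.Prime] (δ : toyIndex.Label → ℕ)

/-! ## 1. Honest data of the family in ceiling shape (w4-d101's lemmas BY NAME) -/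

/-- Every Kummer image is honestly `j²`-scaled (all `(n,m)`-images coincide with the (Ind3)-union; `ksSetting_scaled`). [folklore] -/
theorem ks_thetaRegion_logvol (m : ℤ) (i : Fin toyIndex.lstar) (vQ : toyIndex.VQ) :
    ((ksFull p δ).D (ksSetting p δ).n).logvol _ vQ ((ksSetting p δ).thetaRegion m (Setting.labelSucc i) vQ) =
      (((i : ℕ) + 1 : ℕ) : ℝ) ^ 2 * (ksSetting p δ).qLocal (Setting.labelSucc i) vQ := by
  rw [show (ksSetting p δ).thetaRegion m (Setting.labelSucc i) vQ = (ksSetting p δ).thetaRegion 0 (Setting.labelSucc i) vQ from rfl,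
    ← ksSetting_thetaRegion3]
  exact ksSetting_scaled p δ i vQ

/-- Every Kummer image is admissible. [folklore] -/
theorem ks_thetaRegionsAdm : ThetaRegionsAdm (ksSetting p δ) := fun m i vQ => by
  rw [show (ksSetting p δ).thetaRegion m (Setting.labelSucc i) vQ = (ksSetting p δ).thetaRegion 0 (Setting.labelSucc i) vQ from rfl,
    ← ksSetting_thetaRegion3]
  exact ksSetting_thetaRegion3_adm p δ _ vQ

/-- The Θ-side column volumes are finitely supported (one place). [folklore] -/
theorem ks_thetaAtFinite (m : ℤ) : CandInternal41.ThetaAtFinite (ksFull p δ).toLatticeSituation (ksSetting p δ) m :=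
  fun _ => Set.toFinite _

/-- Step (x), admissibility half, at the setting's line (`ksLine_hAdm`). [folklore] -/
theorem ks_hAdm : ∀ Φ ∈ (unitShells p).Ind1Family ∪ (unitShells p).Ind2Family,
    ∀ (j : toyIndex.Label) (vQ : toyIndex.VQ) (B : Set ((unitShells p).Packet j vQ)),
      ((ksFull p δ).D (ksSetting p δ).n).Adm j vQ B ↔ ((ksFull p δ).D (ksSetting p δ).n).Adm j vQ (Φ j vQ '' B) :=
  ksLine_hAdm p δ 0

/-- Step (x), volume half, at the setting's line (`ksLine_logvolInvariant`). [folklore] -/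
theorem ks_logvolInvariant : ((ksFull p δ).D (ksSetting p δ).n).LogvolInvariant := ksLine_logvolInvariant p δ 0

/-- Admissibility of the (Ind3)-enlarged Θ-regions at the setting's line. [folklore] -/
theorem ks_theta3_adm (j : toyIndex.Label) (vQ : toyIndex.VQ) :
    ((ksFull p δ).D (ksSetting p δ).n).Adm j vQ ((ksSetting p δ).thetaRegion3 j vQ) := ksSetting_thetaRegion3_adm p δ j vQ

/-! ## 2. The column of §A on the family — every row FALSE, for every `δ` -/

/-- **RP-X04a ✗ for every `δ`** (gen-0 ceiling `x04_false_of_bridgeHyps`). [folklore] -/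
theorem x04_false_ks : ¬ CandExplicit4.H (ksFull p δ).toLatticeSituation (ksSetting p δ) :=
  EvalHonestCeiling.x04_false_of_bridgeHyps (ksFull p δ).toLatticeSituation (ksSetting p δ) (ksSetting_bridgeHyps p δ) ⟨1, by decide⟩
    le_rfl () (ksSetting_scaled p δ _ ()) (UnitCosetShell.ksSetting_qLocal_neg p δ _ ())

/-- **RP-C01-VT ✗ for every `δ`.** [folklore] -/
theorem volumeTransport_false_ks : ¬ VolumeTransport (ksSetting p δ) :=
  EvalHonestCeiling.volumeTransport_false_of_bridgeHyps (ksFull p δ).toLatticeSituation (ksSetting p δ) (ksSetting_bridgeHyps p δ)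
    (ks_thetaRegionsAdm p δ) ⟨1, by decide⟩ le_rfl () (ksSetting_scaled p δ _ ()) (UnitCosetShell.ksSetting_qLocal_neg p δ _ ())

/-- **RP-C01-GVT ✗ for every `δ`.** [folklore] -/
theorem globalVolumeTransport_false_ks : ¬ GlobalVolumeTransport (ksSetting p δ) :=
  EvalHonestCeiling.globalVolumeTransport_false_of_bridgeHyps (ksFull p δ).toLatticeSituation (ksSetting p δ) (ksSetting_bridgeHyps p δ)
    (ks_thetaRegionsAdm p δ) (ksSetting_scaled p δ) (ksSetting_indep p δ) (ksSetting_absLogQPos p δ)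

/-- **RP-C01-QFC ✗ for every `δ`** ((ii)(a) `KummerA` from `ksFull_statement`). [folklore] -/
theorem qFrobComparison_false_ks : ¬ QFrobComparison (S' := (ksFull p δ).toLatticeSituation) (ksSetting p δ) :=
  EvalHonestCeiling.no_satPlus_qFrobComparison (ksFull p δ) (ksSetting p δ) () (ksFull_statement p δ) (ksSetting_bridgeHyps p δ)
    (ks_thetaRegionsAdm p δ) (ksSetting_scaled p δ) (UnitCosetShell.ksSetting_qLocal_neg p δ)

/-- **RP-I16 ✓ for every `δ`** (`c = 1/PN(j²)`; abc-iut-rp-d4's ∀-form BY NAME) — insufficient (`¬S`). [folklore] -/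
theorem hDegreeOrbit_ks : CandInternal41.HDegreeOrbit (ksFull p δ).toLatticeSituation (ksSetting p δ) :=
  CandInternal41Profile.hDegreeOrbit_of_scaled _ _ (ks_thetaAtFinite p δ) (ks_thetaRegion_logvol p δ) (ksSetting_indep p δ)

/-- **RP-I17 = I4d′ ✗ for every `δ`.** [folklore] -/
theorem not_hDegreeOrbitGe_ks : ¬ CandInternal41.HDegreeOrbitGe (ksFull p δ).toLatticeSituation (ksSetting p δ) :=
  CandInternal41Profile.not_hDegreeOrbitGe_of_scaled _ _ (ks_thetaRegion_logvol p δ) (ksSetting_indep p δ) (ksSetting_absLogQPos p δ)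

variable (ρ : (∀ v : toyIndex.V, v ∈ toyIndex.Vbad → Set ((unitShells p).StarPacket v)) →
    ∀ (j : toyIndex.Label) (vQ : toyIndex.VQ), Set ((unitShells p).Packet j vQ))
  (qK : ∀ v : toyIndex.V, v ∈ toyIndex.Vbad → Set ((unitShells p).StarPacket v))

/-- **RP-L01 ✗ for every `δ`, `ρ`, `qK`** (cx `l01_false_of_honestData`). [folklore] -/
theorem l01_false_ks : ¬ CandLana1.H (ksFull p δ).toLatticeSituation (ksSetting p δ) ρ qK :=
  EvalHonestCeilingL01.l01_false_of_honestData (ksFull p δ).toLatticeSituation (ksSetting p δ) ρ qK (ksSetting_bridgeHyps p δ)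
    (ks_hAdm p δ) (ks_logvolInvariant p δ) (ksSetting_scaled p δ) (ksSetting_indep p δ) (ksSetting_absLogQPos p δ)

/-- **RP-J02 ✗ for every `δ`** (abc-iut-rp-j1's barrier lemma). [folklore] -/
theorem j02_false_ks : ¬ CandJoshi1.JoshiVolumeDominance (ksSetting p δ) :=
  CandJoshi1Barrier.not_joshiVolumeDominance_of_honestAt (S₀ := (ksFull p δ).toLatticeSituation.toSituation) (ksSetting p δ)
    (ks_hAdm p δ) (ks_logvolInvariant p δ) ⟨1, by decide⟩ le_rfl () (ks_theta3_adm p δ _ ()) (ksSetting_scaled p δ _ ())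
    (UnitCosetShell.ksSetting_qLocal_neg p δ _ ())

/-- **RP-M32b ✗ for every `δ`, `ρ`, `qK`.** [folklore] -/
theorem m32b_false_ks : ¬ CandMochizuki32.H' (ksFull p δ).toLatticeSituation (ksSetting p δ) ρ qK := fun h =>
  j02_false_ks p δ (EvalCoarseProfile.h'_imp_joshiVolumeDominance _ _ ρ qK h)

/-! ## 3. RP-M51 on the family — HOLDS for every `δ`, insufficient -/

/-- Own volume of the `m`-th Θ-pilot Kummer image at the label `i+1`: `−(i+1)²·log p`, for every `δ`. [folklore] -/
theorem ownVolAt_ks (m : ℤ) (i : Fin toyIndex.lstar) (vQ : toyIndex.VQ) :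
    CandMochizuki41.ownVolAt (ksFull p δ).toLatticeSituation (ksSetting p δ) m (Setting.labelSucc i) vQ =
      -((((i : ℕ) + 1 : ℕ) : ℝ) ^ 2) * Real.log p := by
  unfold CandMochizuki41.ownVolAt
  rw [ks_thetaRegion_logvol, ksSetting_qLocal]; ring

/-- **RP-M51 `H` HOLDS for every `δ`**: hull volume `−log p` at the labels `1`, `2` (`ksSetting_thetaLocal`), own volumes `−log p`, `−4·log p`.
[folklore] -/
theorem m41_holds_ks : CandMochizuki41.H (ksFull p δ).toLatticeSituation (ksSetting p δ) := by
  intro hlin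
  obtain ⟨r, hr⟩ := hlin 0 ()
  have h0 := hr ⟨0, by decide⟩
  have h1 := hr ⟨1, by decide⟩
  rw [ksSetting_thetaLocal, ownVolAt_ks, WithTop.coe_eq_coe] at h0 h1
  have hl := log_p_pos p
  push_cast at h0 h1
  nlinarith

/-! ## 4. Package -/

/-- **THE §A COLUMN ON THE GRADED-SHELL FAMILY, for every `δ`, with w4-d101's census BY NAME.** Census: typed Thm. 3.11 ✓, (ii)(b) ✓,
BridgeHyps ✓, three pins ✓, `|log(q)| > 0` ✓, Step (x) ✓, Licence ✓, Statement ✓ WITH EQUALITY, `¬S` for every q-pinned q-datum. Column: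
X04a, C01-VT, C01-GVT, C01-QFC, I17, L01, M32b, J02 FALSE; I16 TRUE; M51 TRUE. None reads `δ`. [folklore] -/
theorem shell_column_sectionA :
    ((ksFull p δ).Statement ∧ ((ksFull p δ).col (ksSetting p δ).n).KummerB ((ksFull p δ).D (ksSetting p δ).n) ∧
      BridgeHyps (ksSetting p δ) ∧ PinnedRegions3 (ksFull p δ).toLatticeSituation (ksSetting p δ) (cosetRegion p) (idealDatum p) ∧
      (ksSetting p δ).AbsLogQPos ∧ ((ksFull p δ).D (ksSetting p δ).n).LogvolInvariant ∧ Thm311ToCor312.Licence (ksSetting p δ) ∧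
      (ksSetting p δ).Statement ∧ (ksSetting p δ).negLogTheta = (((ksSetting p δ).negLogQ : ℝ) : WithTop ℝ) ∧
      (∀ qK', QPinned (ksFull p δ).toLatticeSituation (ksSetting p δ) (cosetRegion p) qK' →
        ¬ PilotKummerIndRelated (ksFull p δ).toLatticeSituation (ksSetting p δ) (cosetRegion p) qK')) ∧
    (¬ CandExplicit4.H (ksFull p δ).toLatticeSituation (ksSetting p δ) ∧ ¬ VolumeTransport (ksSetting p δ) ∧
      ¬ GlobalVolumeTransport (ksSetting p δ) ∧ ¬ QFrobComparison (S' := (ksFull p δ).toLatticeSituation) (ksSetting p δ) ∧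
      ¬ CandInternal41.HDegreeOrbitGe (ksFull p δ).toLatticeSituation (ksSetting p δ) ∧
      ¬ CandLana1.H (ksFull p δ).toLatticeSituation (ksSetting p δ) (cosetRegion p) (idealDatum p) ∧
      ¬ CandMochizuki32.H' (ksFull p δ).toLatticeSituation (ksSetting p δ) (cosetRegion p) (idealDatum p) ∧
      ¬ CandJoshi1.JoshiVolumeDominance (ksSetting p δ)) ∧
    (CandInternal41.HDegreeOrbit (ksFull p δ).toLatticeSituation (ksSetting p δ) ∧
      CandMochizuki41.H (ksFull p δ).toLatticeSituation (ksSetting p δ)) :=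
  ⟨⟨ksFull_statement p δ, kColumn_kummerB_ksLine p δ 0, ksSetting_bridgeHyps p δ, ksSetting_pinnedRegions3 p δ,
      ksSetting_absLogQPos p δ, ks_logvolInvariant p δ, ksSetting_licence p δ, ksSetting_statement p δ,
      ksSetting_negLogTheta_eq_negLogQ p δ, fun qK' hq => ksSetting_not_pilotKummerIndRelated_of_qPinned p δ qK' hq⟩,
    ⟨x04_false_ks p δ, volumeTransport_false_ks p δ, globalVolumeTransport_false_ks p δ, qFrobComparison_false_ks p δ,
      not_hDegreeOrbitGe_ks p δ, l01_false_ks p δ _ _, m32b_false_ks p δ _ _, j02_false_ks p δ⟩,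
    ⟨hDegreeOrbit_ks p δ, m41_holds_ks p δ⟩⟩

/-! ## 5. At the threshold depth `δ⋆ = j²−1`: LIMIT #5's witness rescues no §A row -/

/-- **MODEL-SPACE LIMIT #5, closed from the cx side**: at KS(δ⋆) the containers reading RP-I05 ∧ RP-I05c ∧ RP-I06 ∧ RP-I06⋆ HOLDS
(w4-d101 `containers_dStar`, BY NAME) while EVERY §A row is FALSE (§2 at `δ := dStar`) and S fails (`ksSetting_not_pilotKummerIndRelated`):
the SAT⁺ witness this seat asked for exists, is insufficient, and changes no §A cell. [folklore] -/
theorem limit5_witness_sectionA :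
    (CandInternal2.HInd3Hull (ksFull p dStar).toLatticeSituation (ksSetting p dStar) (cosetRegion p) ∧
      CandInternal11.H (ksFull p dStar).toLatticeSituation (ksSetting p dStar) (cosetRegion p) ∧
      CandInternal2.HQShellOrbit (ksFull p dStar).toLatticeSituation (ksSetting p dStar) (cosetRegion p) (idealDatum p) ∧
      CandInternal11Gap.HQShellOrbitStar (ksFull p dStar).toLatticeSituation (ksSetting p dStar) (cosetRegion p) (idealDatum p)) ∧
    (¬ CandExplicit4.H (ksFull p dStar).toLatticeSituation (ksSetting p dStar) ∧ ¬ VolumeTransport (ksSetting p dStar) ∧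
      ¬ GlobalVolumeTransport (ksSetting p dStar) ∧ ¬ QFrobComparison (S' := (ksFull p dStar).toLatticeSituation) (ksSetting p dStar) ∧
      ¬ CandInternal41.HDegreeOrbitGe (ksFull p dStar).toLatticeSituation (ksSetting p dStar) ∧
      ¬ CandLana1.H (ksFull p dStar).toLatticeSituation (ksSetting p dStar) (cosetRegion p) (idealDatum p) ∧
      ¬ CandMochizuki32.H' (ksFull p dStar).toLatticeSituation (ksSetting p dStar) (cosetRegion p) (idealDatum p) ∧
      ¬ CandJoshi1.JoshiVolumeDominance (ksSetting p dStar)) ∧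
    ¬ PilotKummerIndRelated (ksFull p dStar).toLatticeSituation (ksSetting p dStar) (cosetRegion p) (idealDatum p) :=
  ⟨containers_dStar p, (shell_column_sectionA p dStar).2.1, ksSetting_not_pilotKummerIndRelated p dStar⟩

end Summit.ABC.IUTFork.Repair.EvalShellProfile

end
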